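import Summits.BirchSwinnertonDyer.Rank1Residual.P2.EmptyCellsAtTwo
import Summits.BirchSwinnertonDyer.Rank1Residual.GaloisImage.KuriharaSelmerShaBookkeeping
import Literature.NumberTheory.EllipticCurves.Kato2004.EulerSystemBoundFineSelmerTwo
import Literature.NumberTheory.EllipticCurves.Kato2004.IwasawaH1FreeOfNoRationalTorsionProofs
import Literature.NumberTheory.EllipticCurves.IwasawaAlgebraCharIdealProofs
import Literature.NumberTheory.EllipticCurves.Rank1Residual.Predicates
import HarnessLib

/-!
# Route `ByReductionTypeAtTwo` (rung K4), crux `SupersingularRankZeroAtTwo` (item stmt-BirchSwinnertonDyer-19097), line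
# `odd_blind_package` v2.19, stub 3/5 `stub_flatPackage`, conjunct (8), clauses F3/ZL2 — **FILE Z3 of hand hF3-ZETA: THE GENERATOR
# OF A COPRIME PROPORTIONAL FAMILY** — from classes `x_δ ∈ 𝐇¹` with multipliers `A_δ ∈ Λ`, `A_{δ'} • x_δ = A_δ • x_{δ'}`, and
# «every height-one prime misses some `A_δ`», the UNIQUE `s₀ ∈ 𝐇¹` with `A_δ • s₀ = x_δ` for all `δ`; and the `2^k`-slack twin when
# coprimality is only known at the primes `𝔭 ∌ 2` (cell `bsd-2adic`, seat `bsd-2adic-t42` GEN 51; `--supports 19097`, helper)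

HONEST FRAMING (D-0054): THEOREMS ONLY — no definition, no named fact, no instance, no `sorry`.  PURE ALGEBRA over a Noetherian UFD
(`Λ = ℤ_p⟦T⟧`) and a FREE module over it (`𝐇¹_Γ(T₂W)` on the habitat: `ZetaLineFI.moduleFree_iwasawaH1_of_goodSS_two`), plus the
habitat wrappers.  Helper toward conjunct (8) F3/ZL2 of `FlatCKPackageAtTwo`; closes NO stub; 19097 stays OPEN on its 5 registered stubs;
nothing booked; BSD₂ is proved for no supersingular curve and BSD for no curve by any of this; typed ≠ proved.

## What and why

Kato's zeta element `z_γ` is the common quotient `y^δ / A_δ` of his INTEGRAL classes `y^δ = _{c,d}z`-lifts by their cusp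
multipliers `A_δ = μ_c μ_d·(…) ∈ Λ` (§13.9, §13.12); at every height-one prime `𝔭 ∌ p` some admissible `δ` has `A_δ ∉ 𝔭` (Kato Thm. 12.6
/ §13.12; tree: K3 `KatoBK.cuspBrick_of_isNewformOf` at `p = 2`), and `𝐇¹` is FREE (Thm. 12.4 (3); at `2` on the habitat by the tree).  Hence
`z_γ ∈ 𝐇¹` «up to the prime `(p)`» — this is §13.14.  This file is that algebra, stated over displayed data:
* §1 (any UFD `R`): COPRIME DIVISION `dvd_of_forall_dvd_mul_of_coprime` — `g ≠ 0`, `g ∣ a_δ·h` for all `δ`, every prime misses some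
  `a_δ` ⇒ `g ∣ h` (induction on the prime factorisation of `g`); the slack twin `exists_dvd_pow_mul_of_forall_dvd_mul` — primes `∤ π₀`
  miss some `a_δ` ⇒ `g ∣ π₀^k·h`; and the dictionary from «height-one prime IDEALS `𝔭` (`∌ π₀`)» (the registry's currency) to prime
  ELEMENTS (`height_span_singleton_eq_one_of_prime`).
* §2 (any free module `H` over a UFD): `exists_eq_smul_of_forall_dvd_repr` (coordinatewise division), ★ `exists_generator_of_coprime_family`
  (`∃ s₀, ∀ δ, A_δ • s₀ = x_δ`), `generator_unique`, ★ `exists_generator_pow_of_coprime_family` (`∃ s₀ k, ∀ δ, A_δ • s₀ = π₀^k • x_δ`).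
* §3 (the habitat, `p = 2`, `H = I.H`): ★★ `exists_zetaGenerator_two` / `exists_zetaGenerator_pow_two` and the ZL2-shaped corollary
  ★★ `exists_zetaGenerator_zetaLineLocal_two`: if the `x_δ` are non-zero genuine `2`-adic Euler classes (`Kato2004.IsEulerSystemClassTwo`), the
  generator `s₀` satisfies VERBATIM the local clause «`∀ 𝔭 ht 1, C 2 ∉ 𝔭 → ∃ M s, M ∉ 𝔭 ∧ IsEulerSystemClassTwo s ∧ s ≠ 0 ∧ M • s₀ = s`» of
  conjunct (8) (lines 1633–1637 of the registered `odd_blind_package.lean`).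

References: [Kato2004Asterisque] K. Kato, Astérisque 295 (2004), Thm. 12.4 (2)(3), Thm. 12.5 (4), Thm. 12.6 (pp. 221–222), §13.9 (p. 230),
§13.12–13.14 (pp. 231–234); [Wuthrich2014] Lemma 12, Thm. 13; [BourbakiAC5to7] Ch. VII §3 no. 2 (UFD divisibility), §4 no. 2;
[Washington1997] §13.2.
-/

set_option autoImplicit false
-- the Theorems namespace of this sub repeats the summit name by design (D-0017 nested layout)
set_option linter.dupNamespace false

noncomputable section

open scoped Classical NumberField

namespace Summit.BirchSwinnertonDyer.BirchSwinnertonDyer.Theorems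

namespace SSFlatPackage

open Literature.NumberTheory.EllipticCurves Literature.NumberTheory.GaloisRepresentations ZpExtension

/-! ## §1 Coprime division in a UFD -/

section UFD

variable {R : Type*} [CommRing R] [IsDomain R] [UniqueFactorizationMonoid R] {ι : Type*}

/-- **Coprime division.**  In a UFD, if `g ≠ 0` divides `a_δ·h` for every member of a family `(a_δ)` such that every prime element
misses some `a_δ`, then `g ∣ h` — induction on the prime factorisation of `g`: a prime factor `π` of `g` misses some `a_δ`, so `π ∣ h`,
and one descends to `g/π`, `h/π`. (Kato §13.14 «`Z(f,T)_𝔭 ⊂ 𝐇¹(T)_𝔭` for every height-one `𝔭`», in coordinates.)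
[cite: Kato2004Asterisque, §13.14 (p. 234)] [cite: BourbakiAC5to7, Ch. VII §3 no. 2] -/
theorem dvd_of_forall_dvd_mul_of_coprime (a : ι → R) (hcop : ∀ π : R, Prime π → ∃ i, ¬ π ∣ a i) :
    ∀ {g : R}, g ≠ 0 → ∀ {h : R}, (∀ i, g ∣ a i * h) → g ∣ h := by
  intro g
  induction g using UniqueFactorizationMonoid.induction_on_prime with
  | h₁ => intro h0; exact absurd rfl h0
  | h₂ u hu => intro _ h _; exact hu.dvd
  | h₃ g π hg0 hπ ih =>
    intro _ h hdiv
    obtain ⟨i₀, hi₀⟩ := hcop π hπ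
    -- `π ∣ h`
    have hπh : π ∣ h := by
      have h1 : π ∣ a i₀ * h := (dvd_mul_right π g).trans (hdiv i₀)
      exact (hπ.dvd_or_dvd h1).resolve_left hi₀
    obtain ⟨h', rfl⟩ := hπh
    -- descend: `g ∣ a i * h'`
    have hdiv' : ∀ i, g ∣ a i * h' := fun i ↦ by
      have h2 : π * g ∣ π * (a i * h') := by
        have := hdiv i
        rwa [show a i * (π * h') = π * (a i * h') by ring] at this
      exact (mul_dvd_mul_iff_left hπ.ne_zero).mp h2
    exact mul_dvd_mul_left π (ih hg0 hdiv')

/-- **Coprime division away from one prime `π₀`** (the `p`-power slack twin): if every prime NOT dividing `π₀` misses some `a_δ`, then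
`g ∣ a_δ·h` for all `δ` gives `g ∣ π₀^k·h` for some `k` (the prime factors of `g` associated to `π₀` are paid for by `π₀^k`).
[cite: Kato2004Asterisque, Thm. 12.5 (4) and §13.14 (pp. 222, 234)] [cite: BourbakiAC5to7, Ch. VII §3 no. 2] -/
theorem exists_dvd_pow_mul_of_forall_dvd_mul (a : ι → R) (π₀ : R)
    (hcop : ∀ π : R, Prime π → ¬ π ∣ π₀ → ∃ i, ¬ π ∣ a i) :
    ∀ {g : R}, g ≠ 0 → ∀ {h : R}, (∀ i, g ∣ a i * h) → ∃ k : ℕ, g ∣ π₀ ^ k * h := by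
  intro g
  induction g using UniqueFactorizationMonoid.induction_on_prime with
  | h₁ => intro h0; exact absurd rfl h0
  | h₂ u hu => intro _ h _; exact ⟨0, hu.dvd⟩
  | h₃ g π hg0 hπ ih =>
    intro _ h hdiv
    -- in both cases `g ∣ a i * h` after removing `π` appropriately
    by_cases hπ0 : π ∣ π₀
    · -- the factor `π` is paid for by one power of `π₀`
      have hdiv' : ∀ i, g ∣ a i * h := fun i ↦ (dvd_mul_left g π).trans (hdiv i)
      obtain ⟨k, hk⟩ := ih hg0 hdiv'
      obtain ⟨t, ht⟩ := hπ0
      refine ⟨k + 1, ?_⟩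
      rw [pow_succ]
      refine (mul_dvd_mul_left π hk).trans ⟨t, ?_⟩
      rw [ht]
      ring
    · obtain ⟨i₀, hi₀⟩ := hcop π hπ hπ0
      have hπh : π ∣ h := by
        have h1 : π ∣ a i₀ * h := (dvd_mul_right π g).trans (hdiv i₀)
        exact (hπ.dvd_or_dvd h1).resolve_left hi₀
      obtain ⟨h', rfl⟩ := hπh
      have hdiv' : ∀ i, g ∣ a i * h' := fun i ↦ by
        have h2 : π * g ∣ π * (a i * h') := by
          have := hdiv i
          rwa [show a i * (π * h') = π * (a i * h') by ring] at this
        exact (mul_dvd_mul_iff_left hπ.ne_zero).mp h2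
      obtain ⟨k, hk⟩ := ih hg0 hdiv'
      refine ⟨k, ?_⟩
      rw [show π₀ ^ k * (π * h') = π * (π₀ ^ k * h') by ring]
      exact mul_dvd_mul_left π hk

omit [UniqueFactorizationMonoid R] in
/-- **From height-one prime IDEALS to prime ELEMENTS** (the registry's currency ⇒ §1's): in a Noetherian domain a prime element
generates a height-one prime (`height_span_singleton_eq_one_of_prime`), so «every height-one `𝔭` misses some `A_δ`» gives «every prime
element misses some `A_δ`». [cite: BourbakiAC5to7, Ch. VII §3 no. 2] -/
theorem forall_prime_exists_not_dvd_of_forall_heightOne [IsNoetherianRing R] (a : ι → R)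
    (h : ∀ 𝔭 : PrimeSpectrum R, 𝔭.asIdeal.height = 1 → ∃ i, a i ∉ 𝔭.asIdeal) :
    ∀ π : R, Prime π → ∃ i, ¬ π ∣ a i := by
  intro π hπ
  have hP : (Ideal.span {π}).IsPrime := (Ideal.span_singleton_prime hπ.ne_zero).mpr hπ
  obtain ⟨i, hi⟩ := h ⟨Ideal.span {π}, hP⟩ (Module.height_span_singleton_eq_one_of_prime hπ)
  exact ⟨i, fun hd ↦ hi (Ideal.mem_span_singleton.mpr hd)⟩

omit [UniqueFactorizationMonoid R] in
/-- The same away from `π₀`: «every height-one `𝔭 ∌ π₀` misses some `A_δ`» gives «every prime `π ∤ π₀` misses some `A_δ`».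
[cite: BourbakiAC5to7, Ch. VII §3 no. 2] -/
theorem forall_prime_exists_not_dvd_of_forall_heightOne_not_mem [IsNoetherianRing R] (a : ι → R) (π₀ : R)
    (h : ∀ 𝔭 : PrimeSpectrum R, 𝔭.asIdeal.height = 1 → π₀ ∉ 𝔭.asIdeal → ∃ i, a i ∉ 𝔭.asIdeal) :
    ∀ π : R, Prime π → ¬ π ∣ π₀ → ∃ i, ¬ π ∣ a i := by
  intro π hπ hπ0
  have hP : (Ideal.span {π}).IsPrime := (Ideal.span_singleton_prime hπ.ne_zero).mpr hπ
  obtain ⟨i, hi⟩ := h ⟨Ideal.span {π}, hP⟩ (Module.height_span_singleton_eq_one_of_prime hπ)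
    (fun hm ↦ hπ0 (Ideal.mem_span_singleton.mp hm))
  exact ⟨i, fun hd ↦ hi (Ideal.mem_span_singleton.mpr hd)⟩

end UFD

/-! ## §2 The generator of a coprime proportional family in a FREE module -/

section Free

variable {R : Type*} [CommRing R] [IsDomain R] {H : Type*} [AddCommGroup H] [Module R H] [Module.Free R H] {ι : Type*}

/-- **Coordinatewise division in a free module**: if `g` divides every coordinate of `y` in a basis, then `y = g • c`.
[cite: Kato2004Asterisque, §13.14 (p. 234)] [cite: BourbakiAC5to7, Ch. VII §4 no. 2] -/
theorem exists_eq_smul_of_forall_dvd_repr (g : R) (y : H)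
    (h : ∀ k, g ∣ (Module.Free.chooseBasis R H).repr y k) : ∃ c : H, y = g • c := by
  classical
  set B := Module.Free.chooseBasis R H with hB
  by_cases hg : g = 0
  · refine ⟨0, ?_⟩
    rw [smul_zero]
    apply B.repr.injective
    ext k
    obtain ⟨t, ht⟩ := h k
    rw [ht, hg, zero_mul, map_zero, Finsupp.zero_apply]
  choose q hq using h
  have hsupp : ∀ k, q k ≠ 0 → k ∈ (B.repr y).support := by
    intro k hqk
    rw [Finsupp.mem_support_iff, hq k]
    exact mul_ne_zero hg hqk
  let f := Finsupp.onFinset (B.repr y).support q hsupp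
  refine ⟨B.repr.symm f, ?_⟩
  apply B.repr.injective
  ext k
  rw [hq k, map_smul, LinearEquiv.apply_symm_apply, Finsupp.smul_apply, smul_eq_mul, Finsupp.onFinset_apply]

/-- Cancellation of a non-zero scalar in a free module over a domain (torsion-freeness). [folklore] -/
theorem smul_cancel_of_ne_zero {g : R} (hg : g ≠ 0) {s s' : H} (h : g • s = g • s') : s = s' :=
  (IsRegular.of_ne_zero hg).smul_right_injective H h

/-- **The generator is unique** (one `A_{δ₀} ≠ 0` suffices). [cite: Kato2004Asterisque, §13.9 (p. 230)] -/
theorem generator_unique (x : ι → H) (A : ι → R) (i₀ : ι) (hA0 : A i₀ ≠ 0) {s₀ s₀' : H}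
    (h : ∀ i, A i • s₀ = x i) (h' : ∀ i, A i • s₀' = x i) : s₀ = s₀' :=
  smul_cancel_of_ne_zero hA0 ((h i₀).trans (h' i₀).symm)

omit [IsDomain R] [Module.Free R H] in
/-- **The generator is non-zero iff one (every) `x_δ` with `A_δ ≠ 0` is.** [cite: Kato2004Asterisque, §13.9 (p. 230)] -/
theorem generator_ne_zero (x : ι → H) (A : ι → R) (i₀ : ι) (hx0 : x i₀ ≠ 0) {s₀ : H}
    (h : ∀ i, A i • s₀ = x i) : s₀ ≠ 0 := by
  rintro rfl
  exact hx0 (by rw [← h i₀, smul_zero])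

variable [UniqueFactorizationMonoid R]

/-- ★ **THE GENERATOR OF A COPRIME PROPORTIONAL FAMILY.**  `H` a free module over a UFD, `x : ι → H`, `A : ι → R` with
`A_{δ'} • x_δ = A_δ • x_{δ'}` for all `δ, δ'`, some `A_{δ₀} ≠ 0`, and every prime element missing some `A_δ`.  Then there is `s₀ ∈ H` with
`A_δ • s₀ = x_δ` for EVERY `δ` (coordinates of `x_{δ₀}` are divisible by `A_{δ₀}` by coprime division; then cancel `A_{δ₀}`).  This is Kato's
«`z_γ` is independent of the choices and lies in `𝐇¹`» (§13.9 + §13.14) as pure algebra. [cite: Kato2004Asterisque, §13.9 (p. 230) and §13.14 (p. 234)] -/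
theorem exists_generator_of_coprime_family (x : ι → H) (A : ι → R) (i₀ : ι) (hA0 : A i₀ ≠ 0)
    (hprop : ∀ i j, A j • x i = A i • x j) (hcop : ∀ π : R, Prime π → ∃ i, ¬ π ∣ A i) :
    ∃ s₀ : H, ∀ i, A i • s₀ = x i := by
  classical
  let B := Module.Free.chooseBasis R H
  -- every coordinate of `x i₀` is divisible by `A i₀`
  have hcoord : ∀ k, A i₀ ∣ B.repr (x i₀) k := by
    intro k
    refine dvd_of_forall_dvd_mul_of_coprime A hcop hA0 fun i ↦ ?_
    have := congrArg (fun m : H ↦ B.repr m k) (hprop i₀ i)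
    simp only [map_smul, Finsupp.smul_apply, smul_eq_mul] at this
    exact ⟨B.repr (x i) k, by rw [this]⟩
  obtain ⟨s₀, hs₀⟩ := exists_eq_smul_of_forall_dvd_repr (A i₀) (x i₀) hcoord
  refine ⟨s₀, fun i ↦ smul_cancel_of_ne_zero hA0 ?_⟩
  rw [smul_smul, mul_comm, ← smul_smul, ← hs₀, hprop i₀ i]

/-- ★ **THE GENERATOR WITH `π₀`-POWER SLACK.**  If the prime elements NOT dividing a fixed `π₀` (meant: `π₀ = p`) miss some `A_δ`, then
there are `s₀ ∈ H` and `k` with `A_δ • s₀ = π₀^k • x_δ` for every `δ` (coprime division away from `π₀` on the finitely many non-zero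
coordinates of `x_{δ₀}`, common exponent = their maximum).  This is the shape the finite-index door FZ2 (`ZetaLineFI.zetaLineAtTwo_of_finiteIndex`)
consumes when coprimality AT `(2)` is not available. [cite: Kato2004Asterisque, Thm. 12.5 (4), Thm. 12.6 (p. 222) and §13.14 (p. 234)] -/
theorem exists_generator_pow_of_coprime_family (x : ι → H) (A : ι → R) (i₀ : ι) (hA0 : A i₀ ≠ 0) (π₀ : R)
    (hprop : ∀ i j, A j • x i = A i • x j) (hcop : ∀ π : R, Prime π → ¬ π ∣ π₀ → ∃ i, ¬ π ∣ A i) :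
    ∃ (s₀ : H) (k : ℕ), ∀ i, A i • s₀ = π₀ ^ k • x i := by
  classical
  let B := Module.Free.chooseBasis R H
  -- each coordinate of `x i₀` is divisible by `A i₀` up to a power of `π₀`
  have hcoord : ∀ k, ∃ e : ℕ, A i₀ ∣ π₀ ^ e * B.repr (x i₀) k := by
    intro k
    refine exists_dvd_pow_mul_of_forall_dvd_mul A π₀ hcop hA0 fun i ↦ ?_
    have := congrArg (fun m : H ↦ B.repr m k) (hprop i₀ i)
    simp only [map_smul, Finsupp.smul_apply, smul_eq_mul] at this
    exact ⟨B.repr (x i) k, by rw [this]⟩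
  choose e he using hcoord
  -- a common exponent on the (finite) support
  set N : ℕ := (B.repr (x i₀)).support.sup e with hN
  have hcoordN : ∀ k, A i₀ ∣ B.repr (π₀ ^ N • x i₀) k := by
    intro k
    rw [map_smul, Finsupp.smul_apply, smul_eq_mul]
    by_cases hk : k ∈ (B.repr (x i₀)).support
    · have hle : e k ≤ N := Finset.le_sup hk
      obtain ⟨t, ht⟩ := he k
      refine ⟨π₀ ^ (N - e k) * t, ?_⟩
      rw [show π₀ ^ N = π₀ ^ (N - e k) * π₀ ^ e k by rw [← pow_add, Nat.sub_add_cancel hle], mul_assoc, ht]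
      ring
    · rw [Finsupp.notMem_support_iff.mp hk, mul_zero]
      exact dvd_zero _
  obtain ⟨s₀, hs₀⟩ := exists_eq_smul_of_forall_dvd_repr (A i₀) (π₀ ^ N • x i₀) hcoordN
  refine ⟨s₀, N, fun i ↦ smul_cancel_of_ne_zero hA0 ?_⟩
  rw [smul_smul, mul_comm, ← smul_smul, ← hs₀, smul_comm, hprop i₀ i, smul_comm]

end Free

/-! ## §3 The habitat: `p = 2`, `H = 𝐇¹_Γ(T₂W) = I.H` (free by `ZetaLineFI.moduleFree_iwasawaH1_of_goodSS_two`) -/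

section Habitat

open WeierstrassCurve Literature.NumberTheory.EllipticCurves.Rank1Residual

variable (W : WeierstrassCurve ℚ) [W.IsElliptic] [W.IsGloballyMinimal] [ContinuousSMul ℤ_[2] (W.tateModule 2)]
  {κ : ZpExtension ℚ 2} {γ : Field.absoluteGaloisGroup ℚ} {ι : Type*}

/-- **`𝐇¹_Γ(T₂W)` is `Λ`-free on the habitat** — the tree theorem `ZetaLineFI.moduleFree_iwasawaH1_of_goodSS_two` (p829794), re-derived
here from its two inputs (`IwasawaH1Data.moduleFree_of_torsionBy_eq_bot` ← `W(ℚ)[2] = 0` ← `GoodSS W 2 ⇒ ρ̄₂` irreducible) so that this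
algebra file does not sit in the cone of the route file. [cite: Kato2004Asterisque, Thm. 12.4 (3) (p. 221) and §13.8 (pp. 228–229)] -/
theorem moduleFree_iwasawaH1_two (hss : GoodSS W 2) (hκ : κ.IsCyclotomic) (hγ : κ.IsTopGenerator γ)
    (I : Kato2004.IwasawaH1Data W 2 κ γ) : Module.Free (IwasawaAlgebra 2) I.H := by
  refine Kato2004.IwasawaH1Data.moduleFree_of_torsionBy_eq_bot hκ hγ I ?_
  have h := Summit.BirchSwinnertonDyer.Rank1Residual.GaloisImage.SelmerSha.torsionBy_point_eq_bot W 2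
    (Summit.BirchSwinnertonDyer.Rank1Residual.P2.irr_two_of_goodSS_two W hss) 1
  simpa using h

/-- ★★ **The zeta generator at `2` (exact form).**  On the habitat (`GoodSS W 2`, cyclotomic `(κ, γ)`), for integral classes
`x_δ ∈ 𝐇¹ = I.H` with multipliers `A_δ ∈ Λ = ℤ₂⟦T⟧` such that `A_{δ'} • x_δ = A_δ • x_{δ'}` (file Z2), some `A_{δ₀} ≠ 0`, and EVERY
height-one prime of `Λ` missing some `A_δ` (at `𝔭 ∌ 2`: the cusp brick; AT `𝔭 = (2)`: a displayed input — tower-1's (B1) line), there is a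
UNIQUE `s₀ ∈ 𝐇¹` with `A_δ • s₀ = x_δ` for all `δ`. [cite: Kato2004Asterisque, Thm. 12.4 (3) (p. 221), §13.9 (p. 230), §13.14 (p. 234)]
[cite: Wuthrich2014, Lemma 12 and Thm. 13] -/
theorem exists_zetaGenerator_two (hss : GoodSS W 2) (hκ : κ.IsCyclotomic) (hγ : κ.IsTopGenerator γ)
    (I : Kato2004.IwasawaH1Data W 2 κ γ) (x : ι → I.H) (A : ι → IwasawaAlgebra 2) (i₀ : ι) (hA0 : A i₀ ≠ 0)
    (hprop : ∀ i j, A j • x i = A i • x j)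
    (hcop : ∀ 𝔭 : PrimeSpectrum (IwasawaAlgebra 2), 𝔭.asIdeal.height = 1 → ∃ i, A i ∉ 𝔭.asIdeal) :
    ∃! s₀ : I.H, ∀ i, A i • s₀ = x i := by
  haveI := moduleFree_iwasawaH1_two W hss hκ hγ I
  obtain ⟨s₀, hs₀⟩ := exists_generator_of_coprime_family x A i₀ hA0 hprop
    (forall_prime_exists_not_dvd_of_forall_heightOne A hcop)
  exact ⟨s₀, hs₀, fun s hs ↦ generator_unique x A i₀ hA0 hs hs₀⟩

/-- ★★ **The zeta generator at `2` with `2`-power slack** (coprimality only at the height-one primes `𝔭 ∌ 2` — exactly what the cusp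
brick `KatoBK.cuspBrick_of_isNewformOf` supplies): `∃ s₀ k, ∀ δ, A_δ • s₀ = 2^k • x_δ`. [cite: Kato2004Asterisque, Thm. 12.5 (4), Thm. 12.6
(p. 222), §13.12–13.14 (pp. 231–234)] -/
theorem exists_zetaGenerator_pow_two (hss : GoodSS W 2) (hκ : κ.IsCyclotomic) (hγ : κ.IsTopGenerator γ)
    (I : Kato2004.IwasawaH1Data W 2 κ γ) (x : ι → I.H) (A : ι → IwasawaAlgebra 2) (i₀ : ι) (hA0 : A i₀ ≠ 0)
    (hprop : ∀ i j, A j • x i = A i • x j)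
    (hcop : ∀ 𝔭 : PrimeSpectrum (IwasawaAlgebra 2), 𝔭.asIdeal.height = 1 →
      PowerSeries.C (2 : ℤ_[2]) ∉ 𝔭.asIdeal → ∃ i, A i ∉ 𝔭.asIdeal) :
    ∃ (s₀ : I.H) (k : ℕ), ∀ i, A i • s₀ = (PowerSeries.C (2 : ℤ_[2]) : IwasawaAlgebra 2) ^ k • x i := by
  haveI := moduleFree_iwasawaH1_two W hss hκ hγ I
  exact exists_generator_pow_of_coprime_family x A i₀ hA0 (PowerSeries.C (2 : ℤ_[2]))
    hprop (forall_prime_exists_not_dvd_of_forall_heightOne_not_mem A _ hcop)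

/-- ★★ **The zeta generator carries the ZL2 local clause VERBATIM.**  If moreover the coprimality at each height-one `𝔭 ∌ 2` is
witnessed by a `δ` whose class `x_δ` is a NON-ZERO GENUINE `2`-adic Euler class (`Kato2004.IsEulerSystemClassTwo`; for Kato's lifts:
`isEulerSystemClassTwo_of_zetaBody` + kernel Rohrlich), then the generator `s₀` of `exists_zetaGenerator_two` satisfies, token for token,
the last clause of conjunct (8): `∀ 𝔭 ht 1, C 2 ∉ 𝔭 → ∃ M s, M ∉ 𝔭 ∧ IsEulerSystemClassTwo W hκ I s ∧ s ≠ 0 ∧ M • s₀ = s`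
(`M := A_δ`, `s := x_δ`). [cite: Kato2004Asterisque, Thm. 12.6 (p. 222), §13.12 (pp. 231–233), Thm. 13.4 (2) (p. 226)] -/
theorem exists_zetaGenerator_zetaLineLocal_two [Module.Free ℤ_[2] (W.tateModule 2)] [Module.Finite ℤ_[2] (W.tateModule 2)]
    (hss : GoodSS W 2) (hκ : κ.IsCyclotomic) (hγ : κ.IsTopGenerator γ)
    (I : Kato2004.IwasawaH1Data W 2 κ γ) (x : ι → I.H) (A : ι → IwasawaAlgebra 2) (i₀ : ι) (hA0 : A i₀ ≠ 0)
    (hprop : ∀ i j, A j • x i = A i • x j)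
    (h2 : ∀ 𝔭 : PrimeSpectrum (IwasawaAlgebra 2), 𝔭.asIdeal.height = 1 →
      PowerSeries.C (2 : ℤ_[2]) ∈ 𝔭.asIdeal → ∃ i, A i ∉ 𝔭.asIdeal)
    (hcop : ∀ 𝔭 : PrimeSpectrum (IwasawaAlgebra 2), 𝔭.asIdeal.height = 1 →
      PowerSeries.C (2 : ℤ_[2]) ∉ 𝔭.asIdeal → ∃ i, A i ∉ 𝔭.asIdeal ∧
        Literature.NumberTheory.EllipticCurves.Kato2004.IsEulerSystemClassTwo W hκ I (x i) ∧ x i ≠ 0) :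
    ∃ s₀ : I.H, (∀ i, A i • s₀ = x i) ∧
      ∀ 𝔭 : PrimeSpectrum (IwasawaAlgebra 2), 𝔭.asIdeal.height = 1 →
        PowerSeries.C (2 : ℤ_[2]) ∉ 𝔭.asIdeal →
        ∃ (M : IwasawaAlgebra 2) (s : I.H), M ∉ 𝔭.asIdeal ∧
          Literature.NumberTheory.EllipticCurves.Kato2004.IsEulerSystemClassTwo W hκ I s ∧ s ≠ 0 ∧ M • s₀ = s := by
  have hcop' : ∀ 𝔭 : PrimeSpectrum (IwasawaAlgebra 2), 𝔭.asIdeal.height = 1 → ∃ i, A i ∉ 𝔭.asIdeal := by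
    intro 𝔭 h𝔭
    by_cases hmem : PowerSeries.C (2 : ℤ_[2]) ∈ 𝔭.asIdeal
    · exact h2 𝔭 h𝔭 hmem
    · obtain ⟨i, hi, -, -⟩ := hcop 𝔭 h𝔭 hmem
      exact ⟨i, hi⟩
  obtain ⟨s₀, hs₀, -⟩ := exists_zetaGenerator_two W hss hκ hγ I x A i₀ hA0 hprop hcop'
  refine ⟨s₀, hs₀, fun 𝔭 h𝔭 h2𝔭 ↦ ?_⟩
  obtain ⟨i, hi, hE, hx⟩ := hcop 𝔭 h𝔭 h2𝔭
  exact ⟨A i, x i, hi, hE, hx, hs₀ i⟩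

end Habitat

end SSFlatPackage

end Summit.BirchSwinnertonDyer.BirchSwinnertonDyer.Theorems

end
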